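import Summits.BirchSwinnertonDyer.Rank1Residual.AdditivePotMult.RankZeroShaAnIdentity
import Literature.NumberTheory.EllipticCurves.MatarNekovar2019.ShaIndexBoundIrreducible
import Literature.NumberTheory.EllipticCurves.Rank1Residual.Typed.Basic
import Summits.BirchSwinnertonDyer.Rank1Residual.AdditivePotMult.RankOneHeegner
import Summits.BirchSwinnertonDyer.Rank1Residual.X2.TwistTamagawa
import Literature.NumberTheory.EllipticCurves.HeegnerHypothesisKroneckerProofs
import Literature.NumberTheory.EllipticCurves.ModularityVersionApProofs
import HarnessLib

/-!
# Rank ZERO at an additive potentially multiplicative prime, `E[p]` irreducible (NO surjectivity): the UPPER half of `BSD(E,p)` from the LOWER half of a rank-ONE Heegner twist — the data-level statement for the RESIDUAL-MAP cell E-ii (cell `b2b-bsdres`, sub-cell additive-p1, gen 13)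

HONEST FRAMING (cell `b2b-bsdres`, run/shared/lean/b2b/bsd-rank1-residual/, verbatim in every
file): the goal of the cell is to DELETE the COMBINATION-SHAPED residual classes of the
Birch–Swinnerton-Dyer formula for ALL analytic-rank `≤ 1` elliptic curves over `ℚ` — assembled
STRICTLY from published theorems — so that the rank-`≤ 1` remainder becomes exactly the
CONSTRUCTION-SHAPED classes, which are TYPED, NOT attempted. This is not "finishing BSD".
Sub-cell additive-p1: research route on X3♯(M)/X4(M); labels UNCHANGED; nothing booked.

THEOREMS ONLY (no definition, no named fact).

The rank-ONE twin of this file is gen 10's `RankOneHeegnerOdd.lean` / gen 13's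
`RankOneIrreducibleLowerHalves.lean`: there the UPPER half of a rank-one pair comes from the LOWER
half of its rank-zero Heegner twist. Here the ranks are exchanged: `E` of analytic rank ZERO with
`E[p]` irreducible (cell E-ii allows a NON-surjective image), `K` a Heegner field whose twist
`Wd ≃ E^{(d_K)}` has analytic rank ONE. Ingredients: the rank-zero Gross–Zagier bookkeeping identity
(`exists_shaAn_padicVal_eq_of_heegner_rankZero`, this sub-cell gen 13), Kolyvagin's bound in
Matar–Nekovář's irreducible form (`MatarNekovar2019.thm03_padicValNat_card_sha_le_of_irreducible`,
tree fact A91: `ord_p #Ш(E/K) ≤ 2 ord_p [E(K):ℤy_K]`, `d_K ≠ −3, −4`), and the LOWER half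
`Typed.MissingLowerBoundAt Wd p` of the rank-one twist. Output: `Typed.MissingUpperBoundAt W p`
(`ord_p #Ш(E) ≤ ord_p #Ш(E)_an`) on `p ∤ ∏c(E)·∏c(Wd)`; in general the Tamagawa-defect inequality
`ord_p #Ш(E) ≤ ord_p (L(E,1)/Ω_E) + 2 ord_p #E(ℚ)_tors + ord_p ∏c(Wd)`.

The class-level reading (Heegner field with a rank-one twist from Bump–Friedberg–Hoffstein's
non-vanishing theorem, tree fact `bumpFriedbergHoffstein_exists_heegnerField_split_twist_simpleZero`,
for root number `+1`) is left to the successor: it needs `analyticRank = 1` from a simple zero and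
the rationality of `L(E,1)/Ω_E` (Manin–Drinfeld) as tree lemmas.

References: [MatarNekovar2019] Thm. 0.3, §0.11; [JetchevSkinnerWan2017] §7.4; [GrossZagier1986]
V.§2; [Miller2011LMS] Def. 1.1.
-/

noncomputable section

open scoped Classical

open WeierstrassCurve NumberField Literature.NumberTheory.EllipticCurves
  Literature.NumberTheory.EllipticCurves.ModularForms
  Literature.NumberTheory.EllipticCurves.Rank1Residual
  Literature.NumberTheory.EllipticCurves.Rank1Residual.Typed
  Literature.NumberTheory.EllipticCurves.KrizLi2019
  Literature.NumberTheory.QuadraticFields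

namespace Summit.BirchSwinnertonDyer.Rank1Residual.AdditivePotMult

/-- **Kolyvagin's Tamagawa defect in RANK ZERO at fixed Heegner data, `E[p]` irreducible, relative to
the LOWER half of the rank-ONE twist.** Data as in `exists_shaAn_padicVal_eq_of_heegner_rankZero`
(`W` globally minimal of analytic rank `0`, `K` Heegner for the level `N` with `d_K ≠ −3, −4`, `P`
the Heegner point of `Dt` with `p ∤ c(Dt)`, `p` odd, `p ∤ w_K`, `Wd = Cd • W^{(d_K)}` globally minimal
of analytic rank `1` with `ord_p u(Cd) = 0`, `q₀ = L(E,1)/Ω_E`), plus `E[p]` IRREDUCIBLE, the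
PUBLISHED bound `hMN` (Matar–Nekovář 2019 Thm. 0.3/§0.11) and the LOWER half of the twist
(`MissingLowerBoundAt Wd p`). CONCLUSION: `ord_p #Ш(E) ≤ ord_p q₀ + 2 ord_p #E(ℚ)_tors + ord_p ∏c(Wd)`.
Per Heegner datum; nothing booked. [cite: MatarNekovar2019, Thm. 0.3 (p. 456), §0.11 (p. 457)]
[cite: JetchevSkinnerWan2017, §7.4.1–7.4.2] -/
theorem padicValNat_shaOrder_le_of_heegnerData_of_lowerTwist_rankZero
    (W : WeierstrassCurve ℚ) [W.IsElliptic] [W.IsGloballyMinimal] (p : ℕ) [Fact p.Prime]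
    (N : ℕ) [NeZero N] (K : Type) [Field K] [NumberField K]
    (Dt : ModularParametrizationData W N) (H : HeegnerDatum N (NumberField.discr K)) (ι : K →+* ℂ)
    (P : (W.baseChange K).toAffine.Point)
    (hGZ : gross_zagier N W K) (hKo : kolyvagin N W K)
    (hMN : MatarNekovar2019.thm03_padicValNat_card_sha_le_of_irreducible N W K)
    (hGZK : rank_eq_analyticRank_of_analyticRank_le_one) (hmod : hasEntireLFunction_rat)
    (hK : IsImaginaryQuadratic K) (hHN : SatisfiesHeegnerHypothesis N K)
    (hD3 : NumberField.discr K ≠ -3) (hD4 : NumberField.discr K ≠ -4)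
    (hP : WeierstrassCurve.Affine.Point.map ι.toRatAlgHom P = heegnerPointComplex Dt H)
    (hp2 : p ≠ 2) (hc : ¬ (p : ℤ) ∣ Dt.c) (hμ : ¬ p ∣ Units.torsionOrder K)
    (hr : W.analyticRank = 0) (hirr : Irr W p)
    (Wd : WeierstrassCurve ℚ) [Wd.IsElliptic] [Wd.IsGloballyMinimal] (Cd : VariableChange ℚ)
    (hWd : Cd • W.quadraticTwist (NumberField.discr K : ℚ) = Wd)
    (hu : padicValRat p (Cd.u : ℚ) = 0) (hrd : Wd.analyticRank = 1)
    (q0 : ℚ) (hq0 : W.entireLFunction 1 / (W.realPeriodRat : ℂ) = (q0 : ℂ))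
    (hlow : MissingLowerBoundAt Wd p) :
    (padicValNat p W.shaOrder : ℤ) ≤
      padicValRat p q0 + 2 * padicValNat p W.torsionOrder + padicValNat p Wd.tamagawaProduct := by
  have hpp : p.Prime := Fact.out
  obtain ⟨hfinW, hfinK, hsum, q, hq, hid⟩ :=
    exists_shaAn_padicVal_eq_of_heegner_rankZero W p N K Dt H ι P hGZ hKo hGZK hmod hK hHN hP hp2 hc hμ
      hr Wd Cd hWd hu hrd q0 hq0
  -- the lower half of the twist, on the same rational `q`
  obtain ⟨q', hq', hle⟩ := hlow
  have hqq : q' = q := by exact_mod_cast hq'.symm.trans hq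
  subst hqq
  -- the Heegner point is non-torsion (`L(E,1)·L'(E^{(d_K)},1) ≠ 0`)
  have hD0 : (NumberField.discr K : ℚ) ≠ 0 := by exact_mod_cast NumberField.discr_ne_zero K
  haveI hEt : (W.quadraticTwist (NumberField.discr K : ℚ)).IsElliptic :=
    W.isElliptic_quadraticTwist hD0
  have hLt' : (W.quadraticTwist (NumberField.discr K : ℚ)).entireLFunction = Wd.entireLFunction := by
    rw [← hWd, entireLFunction_smul]
  have hrt : (W.quadraticTwist (NumberField.discr K : ℚ)).analyticRank = 1 := by
    rw [← hrd, ← hWd, analyticRank_smul]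
  have hLt0 : (W.quadraticTwist (NumberField.discr K : ℚ)).entireLFunction 1 = 0 :=
    entireLFunction_one_eq_zero_of_analyticRank_eq_one hrt
  obtain ⟨-, hderivd⟩ := leadingLCoeff_eq_deriv_of_analyticRank_eq_one hrd
  have hLW : W.entireLFunction 1 ≠ 0 := (W.analyticRank_eq_zero_iff_holds (hmod W)).1 hr
  have hLK : LDerivEK W K ≠ 0 := by
    rw [lDerivEK_eq_mul_deriv W K hmod hLt0, hLt']
    exact mul_ne_zero hLW hderivd
  have hPH : IsHeegnerPoint N W K P := ⟨Dt, H, ι, hP⟩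
  have hnt : ¬ IsOfFinAddOrder P :=
    (lDerivEK_ne_zero_iff_not_isOfFinAddOrder W N K hGZ hK hHN hPH).mp hLK
  -- Matar–Nekovář: `ord_p #Ш(E/K) ≤ 2 ord_p I_K`
  have hbound := hMN hK hHN hD3 hD4 hPH hnt hpp hp2 hirr
  haveI : Finite (W.baseChange K).sha := hfinK
  have hKle : (padicValNat p (W.baseChange K).shaOrder : ℤ) ≤
      2 * (padicValNat p (AddSubgroup.zmultiples P).index : ℤ) := by
    unfold WeierstrassCurve.shaOrder; exact_mod_cast hbound
  rw [hsum, Nat.cast_add] at hKle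
  linarith

/-- **The UPPER half `ord_p #Ш(E) ≤ ord_p #Ш(E)_an` in RANK ZERO, `E[p]` irreducible, from the LOWER
half of a rank-ONE Heegner twist, on `p ∤ ∏c_ℓ(E)·∏c_ℓ(Wd)`** (same data; `#Ш(E)_an = q₀·#E(ℚ)_tors²/∏c(E)`
in rank zero). Per Heegner datum; nothing booked. [cite: MatarNekovar2019, Thm. 0.3 (p. 456), §0.11 (p. 457)]
[cite: Miller2011LMS, Def. 1.1] -/
theorem missingUpperBoundAt_of_heegnerData_of_lowerTwist_rankZero
    (W : WeierstrassCurve ℚ) [W.IsElliptic] [W.IsGloballyMinimal] (p : ℕ) [Fact p.Prime]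
    (N : ℕ) [NeZero N] (K : Type) [Field K] [NumberField K]
    (Dt : ModularParametrizationData W N) (H : HeegnerDatum N (NumberField.discr K)) (ι : K →+* ℂ)
    (P : (W.baseChange K).toAffine.Point)
    (hGZ : gross_zagier N W K) (hKo : kolyvagin N W K)
    (hMN : MatarNekovar2019.thm03_padicValNat_card_sha_le_of_irreducible N W K)
    (hGZK : rank_eq_analyticRank_of_analyticRank_le_one) (hmod : hasEntireLFunction_rat)
    (hK : IsImaginaryQuadratic K) (hHN : SatisfiesHeegnerHypothesis N K)
    (hD3 : NumberField.discr K ≠ -3) (hD4 : NumberField.discr K ≠ -4)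
    (hP : WeierstrassCurve.Affine.Point.map ι.toRatAlgHom P = heegnerPointComplex Dt H)
    (hp2 : p ≠ 2) (hc : ¬ (p : ℤ) ∣ Dt.c) (hμ : ¬ p ∣ Units.torsionOrder K)
    (hr : W.analyticRank = 0) (hirr : Irr W p)
    (Wd : WeierstrassCurve ℚ) [Wd.IsElliptic] [Wd.IsGloballyMinimal] (Cd : VariableChange ℚ)
    (hWd : Cd • W.quadraticTwist (NumberField.discr K : ℚ) = Wd)
    (hu : padicValRat p (Cd.u : ℚ) = 0) (hrd : Wd.analyticRank = 1)
    (q0 : ℚ) (hq0 : W.entireLFunction 1 / (W.realPeriodRat : ℂ) = (q0 : ℂ))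
    (hlow : MissingLowerBoundAt Wd p)
    (htam : ¬ p ∣ W.tamagawaProduct) (htamd : ¬ p ∣ Wd.tamagawaProduct) :
    MissingUpperBoundAt W p := by
  have hle := padicValNat_shaOrder_le_of_heegnerData_of_lowerTwist_rankZero W p N K Dt H ι P hGZ hKo
    hMN hGZK hmod hK hHN hD3 hD4 hP hp2 hc hμ hr hirr Wd Cd hWd hu hrd q0 hq0 hlow
  rw [padicValNat.eq_zero_of_not_dvd htamd, Nat.cast_zero, add_zero] at hle
  -- `#Ш(E)_an = q₀ · #E(ℚ)_tors² / ∏c(E)` in rank zero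
  have hrank : W.mordellWeilRank = 0 := by rw [(hGZK W (by rw [hr]; exact zero_le_one)).1, hr]
  have hΩ : (W.realPeriodRat : ℂ) ≠ 0 := by exact_mod_cast W.realPeriodRat_pos_holds.ne'
  have hcpos : 0 < W.tamagawaProduct := W.tamagawaProduct_pos_holds
  have htpos : 0 < W.torsionOrder := W.torsionOrder_pos_holds
  have hsha : shaAn W = ((q0 * (W.torsionOrder : ℚ) ^ 2 / (W.tamagawaProduct : ℚ) : ℚ) : ℂ) := by
    have hL : W.entireLFunction 1 = (q0 : ℂ) * (W.realPeriodRat : ℂ) := by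
      rw [← hq0, div_mul_cancel₀ _ hΩ]
    have hc' : (W.tamagawaProduct : ℂ) ≠ 0 := by exact_mod_cast hcpos.ne'
    rw [shaAn_def, KrizLi2019.leadingLCoeff_eq_of_analyticRank_eq_zero W hr, hL,
      W.regulator_eq_one_of_rank_zero hrank]
    push_cast
    field_simp
  refine ⟨q0 * (W.torsionOrder : ℚ) ^ 2 / (W.tamagawaProduct : ℚ), hsha, ?_⟩
  have hq00 : q0 ≠ 0 := by
    intro h0
    have hLW : W.entireLFunction 1 ≠ 0 := (W.analyticRank_eq_zero_iff_holds (hmod W)).1 hr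
    apply hLW
    have : W.entireLFunction 1 = (q0 : ℂ) * (W.realPeriodRat : ℂ) := by
      rw [← hq0, div_mul_cancel₀ _ hΩ]
    rw [this, h0]; simp
  have ht' : (W.torsionOrder : ℚ) ≠ 0 := by exact_mod_cast htpos.ne'
  have hc' : (W.tamagawaProduct : ℚ) ≠ 0 := by exact_mod_cast hcpos.ne'
  have hv : padicValRat p (q0 * (W.torsionOrder : ℚ) ^ 2 / (W.tamagawaProduct : ℚ)) =
      padicValRat p q0 + 2 * padicValNat p W.torsionOrder := by
    rw [padicValRat.div (mul_ne_zero hq00 (pow_ne_zero 2 ht')) hc', padicValRat.mul hq00 (pow_ne_zero 2 ht'),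
      padicValRat.pow (W.torsionOrder : ℚ), padicValRat.of_nat, padicValRat.of_nat,
      padicValNat.eq_zero_of_not_dvd htam]
    push_cast
    ring
  rw [hv]
  exact hle

/-- **X4(M) ∩ E-ii in the kernel, data level: rank `0`, `p` additive (so `p ∣ N_E` splits in the
Heegner field), NO image hypothesis — the UPPER half from the LOWER half of a rank-one Heegner twist
on `p ∤ ∏c_ℓ(E)`** (`Wd` globally minimal model of `E^{(d_K)}` with `d_K` odd, `d_K < −4`: then
`ord_p u(Cd) = 0` and `ord_p ∏c(Wd) = ord_p ∏c(E)` by eisenstein-p2's odd-`p` Tamagawa transport).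
Nothing booked; X4(M) stays CONSTRUCTION-SHAPED. [cite: MatarNekovar2019, Thm. 0.3 (p. 456), §0.11 (p. 457)]
[cite: SilvermanATAEC1994, IV.9.4 Table 4.1] [cite: Miller2011LMS, Def. 1.1] -/
theorem ClassX4M.missingUpperBoundAt_rankZero_of_heegnerData_of_lowerTwist
    {W : WeierstrassCurve ℚ} [W.IsElliptic] [W.IsGloballyMinimal] {p : ℕ} [Fact p.Prime]
    [NeZero (W.conductorNorm ℤ)] (hX : ClassX4M W p) (hr : W.analyticRank = 0)
    (K : Type) [Field K] [NumberField K]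
    (Dt : ModularParametrizationData W (W.conductorNorm ℤ))
    (H : HeegnerDatum (W.conductorNorm ℤ) (NumberField.discr K)) (ι : K →+* ℂ)
    (P : (W.baseChange K).toAffine.Point)
    (hGZ : gross_zagier (W.conductorNorm ℤ) W K) (hKo : kolyvagin (W.conductorNorm ℤ) W K)
    (hMN : MatarNekovar2019.thm03_padicValNat_card_sha_le_of_irreducible (W.conductorNorm ℤ) W K)
    (hGZK : rank_eq_analyticRank_of_analyticRank_le_one) (hmod : hasEntireLFunction_rat)
    (hK : IsImaginaryQuadratic K) (hHN : SatisfiesHeegnerHypothesis (W.conductorNorm ℤ) K)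
    (hodd : Odd (NumberField.discr K)) (hdK : NumberField.discr K < -4)
    (hP : WeierstrassCurve.Affine.Point.map ι.toRatAlgHom P = heegnerPointComplex Dt H)
    (hc : ¬ (p : ℤ) ∣ Dt.c)
    (Wd : WeierstrassCurve ℚ) [Wd.IsElliptic] [Wd.IsGloballyMinimal] (Cd : VariableChange ℚ)
    (hWd : Cd • W.quadraticTwist (NumberField.discr K : ℚ) = Wd) (hrd : Wd.analyticRank = 1)
    (q0 : ℚ) (hq0 : W.entireLFunction 1 / (W.realPeriodRat : ℂ) = (q0 : ℂ))
    (hlow : MissingLowerBoundAt Wd p) (htam : ¬ p ∣ W.tamagawaProduct) :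
    MissingUpperBoundAt W p := by
  have hp : p.Prime := Fact.out
  have hp2 : p ≠ 2 := hX.p_ne_two
  have hpN : p ∣ W.conductorNorm ℤ :=
    (W.dvd_conductorNorm_iff_not_hasGoodReductionAtPrime p).mpr (not_good_of_addv W p hX.1.2.1)
  have hμ : ¬ p ∣ Units.torsionOrder K := by
    rw [Literature.NumberTheory.DiophantineGeometry.torsionOrder_eq_two_of_discr_lt hK.1 hdK]
    intro h2
    exact hp2 ((Nat.prime_dvd_prime_iff_eq hp Nat.prime_two).mp h2)
  have hu : padicValRat p (Cd.u : ℚ) = 0 :=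
    padicValRat_u_eq_zero_of_twist_minimal_of_dvd W p K hK hHN hpN Cd hWd
  have hpd : ¬ (p : ℤ) ∣ NumberField.discr K :=
    Literature.SatisfiesHeegnerHypothesis.not_dvd_discr hK.1 hHN hp hpN
  have htamd0 : padicValNat p Wd.tamagawaProduct = 0 := by
    rw [X2.padicValNat_tamagawaProduct_twist_of_heegner_of_odd W p hp2 K hK hodd hpd hHN Cd hWd,
      padicValNat.eq_zero_of_not_dvd htam]
  have htamd : ¬ p ∣ Wd.tamagawaProduct := fun h => by
    have h1 := one_le_padicValNat_of_dvd (Wd.tamagawaProduct_pos_holds.ne') h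
    omega
  exact missingUpperBoundAt_of_heegnerData_of_lowerTwist_rankZero W p (W.conductorNorm ℤ) K Dt H ι P
    hGZ hKo hMN hGZK hmod hK hHN (by omega) (by omega) hP hp2 hc hμ hr hX.irr Wd Cd hWd hu hrd q0 hq0
    hlow htam htamd

end Summit.BirchSwinnertonDyer.Rank1Residual.AdditivePotMult

end
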